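import Summits.QuantumFields.BalabanUV.Beta.SymWardLettersUnpacking
import Summits.QuantumFields.BalabanUV.Beta.SymBorderWardSiteLaw
import Summits.QuantumFields.BalabanUV.Beta.KernelWardLevels
import Summits.QuantumFields.BalabanUV.Beta.MixedWardPackingFF

/-!
# `BalabanUV.Beta.CombBorderT2SiteLetter` — binder row D1, the DICTIONARY's ORDER-2 BORDER LETTER for road «FP», PER FINE SITE:
# **THE LITERAL's SECOND-ORDER BORDER TABLE `cB • symVh₂SAn1` (an1's (0.4)-symmetrised row table at lockB `cB = −Lc¹²∕4`) OBEYS THE PER-SITE GAUGE LETTER AGAINST THE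
# FIRST-ORDER BORDER TABLE `cVH • symVhSAt ρ_c` WITH THE CHAIN's GENERATOR `½ • legInd ρ_c u₀` AND THE CHAIN's PREFACTOR `c₀ = (stepScale 3 Lc 0 · Lc⁴)⁻¹` — EXACT, NO REMAINDER**
# (the (T2-B) table letter of `WardLocusCombSecondOrder` ∕ `SymWardLettersAn1.hBord0_sym`, with the block sum `Σ_{v ∈ box}` REMOVED: an1 S2d's SITE law `SymBorderWardSiteLaw.symSiteWardB`
# unpacked into the `MKer` currency exactly as `SymWardLettersUnpacking.hBord0_of_bondWard` unpacks the BOND law)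

WHY.  Road «FP»'s graded torus door displays the second-order rows `c2 ∕ d2 ∕ q2` on the averaging∕border side («OPEN (dictionary)», [D1P3-G19-INBOX-1]); their torus periodisation
(leaf-02's rows lineage) consumes PER-FINE-SITE letters, as `divV_wilsonA_inl_inl` (order 1), `CombFormSlotGaugeLetter` (order 1, levels `j ≥ 1`) and `CombWilsonT2GaugeLetter`
((T2-W)) already are.  The tree had (T2-B) per site only in an1's `KerAt` currency (`symSiteWardB`) and in the `MKer` currency only BLOCK-SUMMED (`hBord0_sym`).  This file is the
per-site `MKer` form at the literal's pins, first jet slot (§1), second jet slot (§2, by the bond symmetry `symVh₂SAn1_swap`), and the field–multiplier block read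
ENTRYWISE (§3, the input shape of the periodisation).
HONEST: [folklore] unpacking BY NAME of an1's landed site law; the remainder is ZERO (exact letter); nothing of Bałaban's asserted; not the torus rows; NOT D1, NOT `BetaPertH`,
NOT continuum, NOT Clay.  HONEST FRAMING (cell contract, verbatim): «discharging `BetaPertH` makes Bałaban's UV stability UNCONDITIONAL — a real constructive-QFT
result; it is NOT the continuum limit and NOT the Clay problem.»  HONEST DEPENDENCY: continuum YM on T⁴ ⇐ BetaPertH ∧ nine spine estimates (0/9 proved);
BetaPertH ⇐ (D1) ∧ (D4) ∧ CAP+tail; G-an2-4 gates asym, D1 and NE2/3/4.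
DERIVED cell leaf ([folklore]; β sub-cell, BINDER-OWNERS row D1 OWNER `b2b-balaban-beta-an2` gen 39).  No `[cite:]`, no `Prop` fact, no `def`.  Provenance: over an1 S2d
`SymBorderWardSiteLaw` ∕ `SymWardLettersUnpacking` ∕ `SymSecondOrderTablesAn1` ∕ `SymAveragingHessianCounts` BY NAME; no existing file touched.
-/

noncomputable section

open Finset
open scoped BigOperators
open Literature.MathematicalPhysics.QuantumFieldTheory
open Literature.MathematicalPhysics.QuantumFieldTheory.Balaban1983to89
open Literature.MathematicalPhysics.QuantumFieldTheory.Balaban1983to89.Beta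
open ExpKernelCalculus (MKer comp)
open OneStepResolventKernel (Fib)
open KernelWard (divV)
open AffineAveraging (box toSite)
open AveragingContours (blk off)
open AveragingContoursRooted (ctr ctrOff)
open AveragingHessianKernels (packVH_inl_inl packVH_inr_inr eq_smul_blk_of_off_eq_zero)
open Summit.QuantumFields.BalabanUV.Beta.TameKernelCalculus
open Summit.QuantumFields.BalabanUV.Beta.BorderedHessian (diagK stepScale comp_diagK_left comp_diagK_right)
open Summit.QuantumFields.BalabanUV.Beta.AveragingWardRootedStencils (legInd legInd_inl legInd_inr)
open Summit.QuantumFields.BalabanUV.Beta.SymAveragingHessianCounts (symVhKerAt symVhSAt symVhSAt_symm)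
open Summit.QuantumFields.BalabanUV.Beta.SymAveragingMixedJetTables (symVh2KerAt)
open Summit.QuantumFields.BalabanUV.Beta.SymSecondOrderTablesAn1 (symVh₂SAn1 symVh₂SAn1_inl_inl symVh₂SAn1_inr_inr symVh₂SAn1_antiTwin symVh₂SAn1_swap)
open Summit.QuantumFields.BalabanUV.Beta.SymWardLettersUnpacking (symVhSAt_inl_inr' symVh₂SAn1_inl_inr)
open Summit.QuantumFields.BalabanUV.Beta.SymBorderWardSiteLaw (symSiteWardB)
open Summit.QuantumFields.BalabanUV.Beta.MixedWardPackingFF (divV_apply)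
open Summit.QuantumFields.BalabanUV.Beta.KernelWardLevels (stepScale_zero)

namespace Summit.QuantumFields.BalabanUV.Beta.CombBorderT2SiteLetter

variable {Lc : ℕ} [NeZero Lc]

/-! ## §1 First jet slot, per fine site -/

/-- [folklore] **(T2-B) PER FINE SITE, FIRST JET SLOT** (any `Lc ≥ 1`; lockB `cB = −Lc¹²∕4`, `cVH = −Lc⁴·½·Lc⁴`, `c₀ = (stepScale 3 Lc 0·Lc⁴)⁻¹`, generator `½ • legInd ρ_c u₀`):
`c₀ • divV (fun κ u => cB • symVh₂SAn1 3 Lc κ u κ′ u′) u₀ = comp (cVH • symVhSAt ρ_c κ′ u′) (diagK (½ • legInd ρ_c u₀)) − comp (diagK (½ • legInd ρ_c u₀)) (cVH • symVhSAt ρ_c κ′ u′)` —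
the block-summed `SymWardLettersAn1.hBord0_sym` with `Σ_{v ∈ box}` removed. -/
theorem divV_borderT2_fst_site (κ' : Fin 4) (u' u₀ : Fin 4 → ℤ) :
    (stepScale 3 Lc 0 * (Lc : ℝ) ^ (3 + 1))⁻¹ • divV (fun κ u => (-((Lc : ℝ) ^ 12 / 4)) • symVh₂SAn1 3 Lc κ u κ' u') u₀ =
      comp ((-((Lc : ℝ) ^ (3 + 1) * (1 / 2) * (Lc : ℝ) ^ (3 + 1))) • symVhSAt (ctr 4 Lc) 3 Lc rfl κ' u')
          (diagK ((1 / 2 : ℝ) • legInd (ctr 4 Lc) u₀))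
        - comp (diagK ((1 / 2 : ℝ) • legInd (ctr 4 Lc) u₀))
          ((-((Lc : ℝ) ^ (3 + 1) * (1 / 2) * (Lc : ℝ) ^ (3 + 1))) • symVhSAt (ctr 4 Lc) 3 Lc rfl κ' u') := by
  have hL1 : 1 ≤ Lc := Nat.one_le_iff_ne_zero.mpr (NeZero.ne Lc)
  have hL : (Lc : ℝ) ≠ 0 := by exact_mod_cast NeZero.ne Lc
  funext x z a b
  rw [Pi.smul_apply, Pi.smul_apply, Pi.smul_apply, Pi.smul_apply, smul_eq_mul, divV_apply, Pi.sub_apply, Pi.sub_apply, Pi.sub_apply,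
    Pi.sub_apply, comp_diagK_right, comp_diagK_left, Pi.smul_apply, Pi.smul_apply, Pi.smul_apply, Pi.smul_apply, smul_eq_mul,
    Pi.smul_apply, Pi.smul_apply, smul_eq_mul, Pi.smul_apply, Pi.smul_apply, smul_eq_mul, stepScale_zero, one_mul]
  rcases a with β | m₀ <;> rcases b with β' | m
  · -- (inl, inl): everything vanishes
    simp only [Pi.smul_apply, smul_eq_mul, symVh₂SAn1_inl_inl, mul_zero, sub_self, Finset.sum_const_zero]
    unfold symVhSAt; rw [packVH_inl_inl]; ring
  · -- (inl β, inr m): the site law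
    simp only [Pi.smul_apply, smul_eq_mul, symVh₂SAn1_inl_inr, symVhSAt_inl_inr', legInd_inl, legInd_inr]
    by_cases hz : off Lc z = 0
    · simp only [hz, if_true]
      have h := symSiteWardB (Lc := Lc) u₀ m (blk Lc z) β x κ' u'
      have hzb : (Lc : ℤ) • blk Lc z = z := (eq_smul_blk_of_off_eq_zero hL1 hz).symm
      rw [hzb] at h
      have e1 : (if u₀ = z + ctr 4 Lc then (1 : ℝ) else 0) = (if z + ctr 4 Lc = u₀ then (1 : ℝ) else 0) := by
        simp only [eq_comm]
      have e2 : (if u₀ = x then (1 : ℝ) else 0) = (if x = u₀ then (1 : ℝ) else 0) := by simp only [eq_comm]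
      rw [e1, e2] at h
      simp only [← mul_sub, ← Finset.mul_sum] at h ⊢
      rw [h, inv_mul_eq_iff_eq_mul₀ (pow_ne_zero _ hL)]
      ring
    · simp only [hz, if_false, mul_zero, sub_self, Finset.sum_const_zero, zero_mul]
  · -- (inr m₀, inl β'): the anti-twin mirror at (z, x)
    simp only [Pi.smul_apply, smul_eq_mul, symVh₂SAn1_antiTwin, symVh₂SAn1_inl_inr]
    rw [symVhSAt_symm, symVhSAt_inl_inr', legInd_inl, legInd_inr]
    by_cases hx : off Lc x = 0
    · simp only [hx, if_true]
      have h := symSiteWardB (Lc := Lc) u₀ m₀ (blk Lc x) β' z κ' u'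
      have hxb : (Lc : ℤ) • blk Lc x = x := (eq_smul_blk_of_off_eq_zero hL1 hx).symm
      rw [hxb] at h
      have e1 : (if u₀ = x + ctr 4 Lc then (1 : ℝ) else 0) = (if x + ctr 4 Lc = u₀ then (1 : ℝ) else 0) := by
        simp only [eq_comm]
      have e2 : (if u₀ = z then (1 : ℝ) else 0) = (if z = u₀ then (1 : ℝ) else 0) := by simp only [eq_comm]
      rw [e1, e2] at h
      have h2 := congrArg Neg.neg h
      rw [← Finset.sum_neg_distrib] at h2
      simp only [neg_sub] at h2
      simp only [neg_sub_neg, ← mul_sub, ← Finset.mul_sum] at h2 ⊢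
      rw [h2, inv_mul_eq_iff_eq_mul₀ (pow_ne_zero _ hL)]
      ring
    · simp only [hx, if_false, mul_zero, neg_zero, sub_self, Finset.sum_const_zero, zero_mul]
  · -- (inr, inr): everything vanishes
    simp only [Pi.smul_apply, smul_eq_mul, symVh₂SAn1_inr_inr, mul_zero, sub_self, Finset.sum_const_zero]
    unfold symVhSAt; rw [packVH_inr_inr]; ring

/-! ## §2 Second jet slot, per fine site (by the bond symmetry of the row table) -/

/-- [folklore] **(T2-B) PER FINE SITE, SECOND JET SLOT**: the same letter for the family in the second jet bond — `symVh₂SAn1` is symmetric in its two jet bonds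
(`SymSecondOrderTablesAn1.symVh₂SAn1_swap`), so §1 applies with the bonds renamed (the per-site twin of `SymWardLettersUnpacking.hBord0''_of_bondWard`). -/
theorem divV_borderT2_snd_site (κ : Fin 4) (u u₀ : Fin 4 → ℤ) :
    (stepScale 3 Lc 0 * (Lc : ℝ) ^ (3 + 1))⁻¹ • divV (fun κ' u' => (-((Lc : ℝ) ^ 12 / 4)) • symVh₂SAn1 3 Lc κ u κ' u') u₀ =
      comp ((-((Lc : ℝ) ^ (3 + 1) * (1 / 2) * (Lc : ℝ) ^ (3 + 1))) • symVhSAt (ctr 4 Lc) 3 Lc rfl κ u)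
          (diagK ((1 / 2 : ℝ) • legInd (ctr 4 Lc) u₀))
        - comp (diagK ((1 / 2 : ℝ) • legInd (ctr 4 Lc) u₀))
          ((-((Lc : ℝ) ^ (3 + 1) * (1 / 2) * (Lc : ℝ) ^ (3 + 1))) • symVhSAt (ctr 4 Lc) 3 Lc rfl κ u) := by
  have e : (fun κ' u' => (-((Lc : ℝ) ^ 12 / 4)) • symVh₂SAn1 3 Lc κ u κ' u') =
      fun κ' u' => (-((Lc : ℝ) ^ 12 / 4)) • symVh₂SAn1 3 Lc κ' u' κ u := by
    funext κ' u'; rw [symVh₂SAn1_swap]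
  rw [e]
  exact divV_borderT2_fst_site κ u u₀

/-! ## §3 The field–multiplier block, entrywise (the input shape of the torus periodisation) -/

/-- [folklore] **(T2-B) PER FINE SITE, FIRST JET SLOT, ENTRYWISE ON THE FIELD–MULTIPLIER BLOCK**: at a fine field leg `(x, β)` and a multiplier leg `(z, m)` with `z` on the
coarse lattice (`off Lc z = 0`), `c₀ · (divV (cB • symVh₂SAn1 … κ′ u′) u₀) x z (inl β) (inr m) = cVH · m^sym_{(m, blk z)}((β,x),(κ′,u′)) · (½[z + ρ_c = u₀] − ½[x = u₀])`. -/
theorem divV_borderT2_fst_site_inl_inr (κ' : Fin 4) (u' u₀ x z : Fin 4 → ℤ) (β m : Fin 4) (hz : off Lc z = 0) :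
    (stepScale 3 Lc 0 * (Lc : ℝ) ^ (3 + 1))⁻¹ * divV (fun κ u => (-((Lc : ℝ) ^ 12 / 4)) • symVh₂SAn1 3 Lc κ u κ' u') u₀ x z (Sum.inl β) (Sum.inr m) =
      (-((Lc : ℝ) ^ (3 + 1) * (1 / 2) * (Lc : ℝ) ^ (3 + 1))) * symVhKerAt (ctr 4 Lc) Lc m (blk Lc z) (β, x) (κ', u')
        * ((1 / 2 : ℝ) * (if z + ctr 4 Lc = u₀ then 1 else 0) - (1 / 2 : ℝ) * (if x = u₀ then 1 else 0)) := by
  have h := congrFun (congrFun (congrFun (congrFun (divV_borderT2_fst_site (Lc := Lc) κ' u' u₀) x) z) (Sum.inl β)) (Sum.inr m)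
  rw [Pi.smul_apply, Pi.smul_apply, Pi.smul_apply, Pi.smul_apply, smul_eq_mul, Pi.sub_apply, Pi.sub_apply, Pi.sub_apply, Pi.sub_apply,
    comp_diagK_right, comp_diagK_left, Pi.smul_apply, Pi.smul_apply, Pi.smul_apply, Pi.smul_apply, smul_eq_mul,
    Pi.smul_apply, Pi.smul_apply, smul_eq_mul, Pi.smul_apply, Pi.smul_apply, smul_eq_mul, symVhSAt_inl_inr', legInd_inl, legInd_inr] at h
  simp only [hz, if_true] at h
  rw [h]
  ring

end Summit.QuantumFields.BalabanUV.Beta.CombBorderT2SiteLetter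

end
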